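import Literature.MathematicalPhysics.QuantumLattice.FermionQuasiFreeWick
import Literature.MathematicalPhysics.QuantumLattice.FinDimSpectrumGibbsLimitProofs
import Literature.MathematicalPhysics.QuantumLattice.HubbardWave0LiebProofs
import Literature.MathematicalPhysics.QuantumLattice.HubbardHubbardModelEtaODLROProofs
import HarnessLib

/-!
# The Hartree–Fock (Slater-determinant) variational upper bound for the Hubbard model

Topic `MathematicalPhysics/QuantumLattice`, family `hubbard`. For the Hubbard Hamiltonian
`H = -t Σ_{⟨xy⟩,σ} c†_{xσ} c_{yσ} + U Σ_x n_{x↑} n_{x↓}` on a finite graph (`hamiltonian G t U`,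
`HubbardWave0.lean`) and ANY orthogonal projection `P` on the one-particle space `Orb Λ → ℂ`
with `tr P = N`, the `N`-particle ground-state energy obeys the **Hartree–Fock bound**
`E₀(N) ≤ E_HF(P) := tr (T P) + U Σ_x (P_{x↑,x↑} P_{x↓,x↓} - P_{x↑,x↓} P_{x↓,x↑})`
(`groundEnergyAt_le_hfEnergy`): Bach–Lieb–Solovej, *Generalized Hartree–Fock theory and the
Hubbard model*, J. Stat. Phys. 76 (1994) 3–89, eqs. (2c.7)–(2c.8) (the energy of a quasi-free
state is the functional `ℰ(γ)`; direct minus exchange term) and (2c.34)–(2c.36)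
(`E^Q ≤ ℰ(γ)` for `γ` an `N`-dimensional projection, i.e. the one-particle density matrix of a
Slater determinant). This is the soundness statement behind every Hartree–Fock-type certified
UPPER bound on Hubbard ground-state energies (the antiferromagnetic Hartree–Fock / Langer–Mattis
upper curve, spin-density-wave Slater states on finite tori).

## The proof formalised (BLS94 §2b–2c, finite dimension)

We do not build the Slater determinant. Instead, following BLS94 Thm 2.3 / Lemma 2.5 (the Gibbs
state of a quadratic Hamiltonian `Σ e_i c†_i c_i` is quasi-free and is determined by its
one-particle density matrix), we use the quasi-free Gibbs states `ω_β` of `K = dΓ(1 - 2P)`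
(energy `-1` on `ran P`, `+1` on `ker P`), whose Wick/determinant structure is ALREADY a tree
theorem (`gibbsState_dGamma_nestedWord`, `thermalCorr_dGamma_creation_annihilation` of
`FermionQuasiFree(Wick).lean`), and the tree's zero-temperature limit
`tendsto_gibbsState_atTop_holds` (`ω_β → ω_∞ =` tracial ground state of `K`):

* `exp_smul_of_mul_self` — `exp (s • P) = 1 + (e^s - 1) • P` for idempotent `P` (exponential
  series); hence `(1 + e^{βK₁})⁻¹ = (1 + e^β)⁻¹ (1 - P) + (1 + e^{-β})⁻¹ P` for `K₁ = 1 - 2P`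
  (`inv_one_add_exp_hfOneBody`) and the two-point function `ω_β(c†_i c_j) → P_{ji}`
  (`tendsto_gibbsState_two_point`, `groundStateFunctional_two_point`);
* `gibbsState_numberAt_mul_numberAt` — Wick for `⟨n_a n_b⟩_β = ⟨n_a⟩⟨n_b⟩ - ⟨c†_a c_b⟩⟨c†_b c_a⟩`
  (`a ≠ b`; the `2 × 2` case of the determinant formula + CAR), and its limit
  `ω_∞(n_a n_b) = P_{aa} P_{bb} - P_{ba} P_{ab}` (`groundStateFunctional_numberAt_mul_numberAt`);
* `groundStateFunctional_totalNumberOp_sq` — `ω_∞(N̂) = N`, `ω_∞(N̂²) = N²` (`tr P² = tr P`;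
  BLS94 Remark after Thm 2.3: a quasi-free state has definite particle number iff `γ` is a
  projection, computed from `ρ(𝒩²) = Σ_{k,l} ρ(c†_k c_k c†_l c_l)` by Wick), so
  `ω_∞((N̂ - N)²) = 0` and the ground projector `P₀` of `K` satisfies `N̂ P₀ = N P₀`
  (`totalNumberOp_mul_groundProj`): `ω_∞` is a mixture of `N`-particle vector states;
* `groundEnergy_le_re_groundStateFunctional` — hence `E₀(N) ≤ re ω_∞(H)` for ANY operator `H`
  (variational principle `groundEnergy_mul_norm_le` column by column of `P₀`);
* `groundStateFunctional_hamiltonian` — `ω_∞(H) = E_HF(P)` for the Hubbard Hamiltonian, and the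
  main theorem `groundEnergyAt_le_hfEnergy`.

Everything is proved; the only definition is the functional `hfEnergy` (with a body). No named
facts.

## Mathlib / tree search

Tree (REUSED): `dGamma`, `thermalCorr_dGamma_creation_annihilation`, `gibbsState_dGamma_nestedWord`,
`nestedWord`, `wordOp`, `letterOp` (`FermionQuasiFree`, `FermionQuasiFreeWick`,
`FermionTraceFactorization`); `Matrix.gibbsState`, `Matrix.groundStateFunctional`,
`Matrix.groundProj`, `groundProj_isHermitian`, `groundProj_mul_self`, `trace_groundProj_pos`,
`groundStateFunctional_one`, `tendsto_gibbsState_atTop_holds` (`FinDimSpectrum*`);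
`totalNumberOp_eq_diagonal`, `numberAt`, CAR discharges (`FermionOperators(Proofs)`);
`LiebThm1.groundEnergy_mul_norm_le` (`HubbardWave0LiebProofs`); `EtaPairingODLRO.orb_zero_ne_orb_one`
(`HubbardHubbardModelEtaODLROProofs`). Mathlib: `NormedSpace.exp`,
`exp_series_hasSum_exp'`, `exp_add_of_commute`, `Complex.exp_eq_exp_ℂ`, `hasSum_ite_eq`,
`Matrix.inv_eq_right_inv`, `Matrix.det_fin_two`, `Matrix.PosSemidef.trace_eq_zero_iff`,
`Matrix.conjTranspose_mul_self_eq_zero`, `Real.tendsto_exp_atTop`,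
`Real.tendsto_exp_neg_atTop_nhds_zero`. `lean search 'hartreeFock|HartreeFock|slater.*le_'`:
no Hartree–Fock energy bound in Mathlib or the tree.

## References

* V. Bach, E. H. Lieb, J. P. Solovej, *Generalized Hartree–Fock theory and the Hubbard model*,
  J. Stat. Phys. 76 (1994) 3–89, arXiv:cond-mat/9312044; §2b (quasi-free states: Thm 2.3 and the
  Remark following it, Lemma 2.5 eqs. (2b.41)–(2b.42) = Gibbs states of quadratic Hamiltonians,
  Lemma 2.7 eq. (2b.49)), §2c eqs. (2c.7)–(2c.8), (2c.34)–(2c.36). [BachLiebSolovej1994]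
* E. H. Lieb, *Variational principle for many-fermion systems*, PRL 46 (1981) 457 (the general
  `0 ≤ γ ≤ 1` version, not needed here). [folklore]
* O. Bratteli, D. W. Robinson, *Operator Algebras and Quantum Statistical Mechanics 2*, §5.2.4
  (gauge-invariant quasi-free states). [BratteliRobinsonII1997]
-/

noncomputable section

namespace Literature.MathematicalPhysics.QuantumLattice

open NormedSpace Matrix Finset Filter Topology
open scoped ComplexOrder

namespace HartreeFock

/-! ### The exponential of an idempotent and the Fermi matrix of `dΓ(1 - 2P)` -/

section Exponential

open scoped Matrix.Norms.Operator

variable {ι : Type*} [Fintype ι] [DecidableEq ι]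

/-- `P ^ (n + 1) = P` for an idempotent matrix. [folklore] -/
theorem pow_succ_eq_of_mul_self {P : Matrix ι ι ℂ} (hP : P * P = P) (n : ℕ) :
    P ^ (n + 1) = P := by
  induction n with
  | zero => rw [zero_add, pow_one]
  | succ n ih => rw [pow_succ, ih, hP]

/-- **`exp (s • P) = 1 + (e^s - 1) • P` for an idempotent matrix `P`** (the exponential series:
`(s • P)^n = s^n • P` for `n ≥ 1`). [folklore] -/
theorem exp_smul_of_mul_self {P : Matrix ι ι ℂ} (hP : P * P = P) (s : ℂ) :
    exp (s • P) = 1 + (Complex.exp s - 1) • P := by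
  have hterm : ∀ n : ℕ, ((n.factorial : ℂ)⁻¹ • (s • P) ^ n) =
      ((n.factorial : ℂ)⁻¹ * s ^ n) • P + (if n = 0 then 1 - P else 0) := by
    intro n
    rcases n with _ | n
    · simp
    · rw [if_neg (Nat.succ_ne_zero n), add_zero, smul_pow, pow_succ_eq_of_mul_self hP,
        smul_smul]
  have h1 : HasSum (fun n : ℕ => ((n.factorial : ℂ)⁻¹ * s ^ n) • P) (Complex.exp s • P) := by
    have hs : HasSum (fun n : ℕ => (n.factorial : ℂ)⁻¹ • s ^ n) (exp s) :=
      exp_series_hasSum_exp' (𝕂 := ℂ) s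
    rw [Complex.exp_eq_exp_ℂ]
    simpa only [smul_eq_mul] using hs.smul_const P
  have h2 : HasSum (fun n : ℕ => if n = 0 then (1 : Matrix ι ι ℂ) - P else 0) (1 - P) :=
    hasSum_ite_eq 0 (1 - P)
  have h3 : HasSum (fun n : ℕ => (n.factorial : ℂ)⁻¹ • (s • P) ^ n)
      (Complex.exp s • P + (1 - P)) := by
    simpa only [hterm] using h1.add h2
  have h4 : HasSum (fun n : ℕ => (n.factorial : ℂ)⁻¹ • (s • P) ^ n) (exp (s • P)) :=
    exp_series_hasSum_exp' (𝕂 := ℂ) (s • P)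
  rw [h4.unique h3, sub_smul, one_smul]
  abel

/-- `exp (s • 1) = e^s • 1`. [folklore] -/
theorem exp_smul_one (s : ℂ) : exp (s • (1 : Matrix ι ι ℂ)) = Complex.exp s • (1 : Matrix ι ι ℂ) := by
  rw [exp_smul_of_mul_self (Matrix.mul_one 1), sub_smul, one_smul]
  abel

/-- The Hartree–Fock reference one-body operator `1 - 2P`: energy `-1` on `ran P`, `+1` on
`ker P`. [folklore] -/
def hfOneBody (P : Matrix ι ι ℂ) : Matrix ι ι ℂ := 1 - P - P

omit [Fintype ι] in
/-- `1 - 2P` is Hermitian for Hermitian `P`. [folklore] -/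
theorem isHermitian_hfOneBody {P : Matrix ι ι ℂ} (hP : P.IsHermitian) : (hfOneBody P).IsHermitian :=
  (isHermitian_one.sub hP).sub hP

/-- `e^{β(1 - 2P)} = e^β (1 - P) + e^{-β} P` for idempotent `P`. [folklore] -/
theorem exp_smul_hfOneBody {P : Matrix ι ι ℂ} (hP : P * P = P) (β : ℂ) :
    exp (β • hfOneBody P) = Complex.exp β • (1 - P) + Complex.exp (-β) • P := by
  have hsplit : β • hfOneBody P = β • (1 : Matrix ι ι ℂ) + (-(2 * β)) • P := by
    simp only [hfOneBody, smul_sub]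
    module
  have hcomm : Commute (β • (1 : Matrix ι ι ℂ)) ((-(2 * β)) • P) :=
    ((Commute.one_left P).smul_left β).smul_right _
  rw [hsplit, Matrix.exp_add_of_commute _ _ hcomm, exp_smul_one, exp_smul_of_mul_self hP, smul_mul_assoc,
    one_mul, smul_add, smul_smul, mul_sub, mul_one, ← Complex.exp_add]
  have hβ : β + -(2 * β) = -β := by ring
  rw [hβ, smul_sub, sub_smul]
  module

/-- For real `β`: `1 + e^{β(1-2P)} = (1 + e^β)(1 - P) + (1 + e^{-β}) P` has the inverse
`(1 + e^β)⁻¹ (1 - P) + (1 + e^{-β})⁻¹ P` (idempotent `P`). [folklore] -/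
theorem inv_one_add_exp_hfOneBody {P : Matrix ι ι ℂ} (hP : P * P = P) (β : ℝ) :
    (1 + exp ((β : ℂ) • hfOneBody P))⁻¹ =
      (((1 + Real.exp β)⁻¹ : ℝ) : ℂ) • (1 - P) + (((1 + Real.exp (-β))⁻¹ : ℝ) : ℂ) • P := by
  set a : ℝ := Real.exp β with ha
  set b : ℝ := Real.exp (-β) with hb
  have ha0 : (1 + a : ℂ) ≠ 0 := by
    have : (0 : ℝ) < 1 + a := by positivity
    exact_mod_cast this.ne'
  have hb0 : (1 + b : ℂ) ≠ 0 := by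
    have : (0 : ℝ) < 1 + b := by positivity
    exact_mod_cast this.ne'
  have hQ : (1 - P) * (1 - P) = 1 - P := by
    rw [sub_mul, mul_sub, mul_sub, one_mul, mul_one, one_mul, hP, sub_self, sub_zero]
  have hPQ : P * (1 - P) = 0 := by rw [mul_sub, mul_one, hP, sub_self]
  have hQP : (1 - P) * P = 0 := by rw [sub_mul, one_mul, hP, sub_self]
  have hE : 1 + exp ((β : ℂ) • hfOneBody P) = ((1 + a : ℝ) : ℂ) • (1 - P) + ((1 + b : ℝ) : ℂ) • P := by
    rw [exp_smul_hfOneBody hP, ← Complex.ofReal_neg, ← Complex.ofReal_exp, ← Complex.ofReal_exp,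
      ← ha, ← hb]
    push_cast
    rw [add_smul, add_smul, one_smul, one_smul]
    abel
  apply Matrix.inv_eq_right_inv
  rw [hE]
  push_cast
  rw [add_mul, mul_add, mul_add, smul_mul_smul, smul_mul_smul, smul_mul_smul, smul_mul_smul, hQ,
    hPQ, hQP, hP, smul_zero, smul_zero, add_zero, zero_add, mul_inv_cancel₀ ha0,
    mul_inv_cancel₀ hb0, one_smul, one_smul, sub_add_cancel]

/-- `(1 + e^β)⁻¹ → 0` as `β → ∞`. [folklore] -/
theorem tendsto_inv_one_add_exp : Tendsto (fun β : ℝ => (1 + Real.exp β)⁻¹) atTop (𝓝 0) :=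
  tendsto_inv_atTop_zero.comp (tendsto_atTop_add_const_left _ _ Real.tendsto_exp_atTop)

/-- `(1 + e^{-β})⁻¹ → 1` as `β → ∞`. [folklore] -/
theorem tendsto_inv_one_add_exp_neg : Tendsto (fun β : ℝ => (1 + Real.exp (-β))⁻¹) atTop (𝓝 1) := by
  have h : Tendsto (fun β : ℝ => 1 + Real.exp (-β)) atTop (𝓝 (1 + 0)) :=
    tendsto_const_nhds.add Real.tendsto_exp_neg_atTop_nhds_zero
  have h' := h.inv₀ (by norm_num)
  simpa using h'

end Exponential

/-! ### Two-point function and Wick pairs in the quasi-free Gibbs states of `dΓ(1 - 2P)` -/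

section Gibbs

variable {ι : Type*} [LinearOrder ι] [Fintype ι]

/-- The Fermi matrix of `dΓ(1 - 2P)`: `⟨c†_i c_j⟩_β = (1 + e^β)⁻¹ (1 - P)_{ji} + (1 + e^{-β})⁻¹ P_{ji}`
(idempotent Hermitian `P`): the one-particle density matrix `(1 + e^{A})⁻¹` of the Gibbs state of
a second quantization of `A`, BLS94 Lemma 2.5 eqs. (2b.41)–(2b.42), at `A = β(1 - 2P)`;
Bratteli–Robinson II §5.2.4. [cite: BachLiebSolovej1994, Lemma 2.5] -/
theorem gibbsState_two_point {P : Matrix ι ι ℂ} (hP : P.IsHermitian) (hPP : P * P = P) (β : ℝ)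
    (i j : ι) :
    gibbsState β (dGamma (hfOneBody P)) (creation i * annihilation j) =
      (((1 + Real.exp β)⁻¹ : ℝ) : ℂ) * (1 - P) j i + (((1 + Real.exp (-β))⁻¹ : ℝ) : ℂ) * P j i := by
  have h := thermalCorr_dGamma_creation_annihilation (isHermitian_hfOneBody hP) β i j
  rw [thermalCorr] at h
  rw [h, inv_one_add_exp_hfOneBody hPP, Matrix.add_apply, Matrix.smul_apply, Matrix.smul_apply,
    smul_eq_mul, smul_eq_mul]

/-- **Zero-temperature two-point function**: `⟨c†_i c_j⟩_β → P_{ji}` as `β → ∞`. [folklore] -/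
theorem tendsto_gibbsState_two_point {P : Matrix ι ι ℂ} (hP : P.IsHermitian) (hPP : P * P = P)
    (i j : ι) :
    Tendsto (fun β : ℝ => gibbsState β (dGamma (hfOneBody P)) (creation i * annihilation j)) atTop
      (𝓝 (P j i)) := by
  have h0 : Tendsto (fun β : ℝ => ((((1 + Real.exp β)⁻¹ : ℝ) : ℂ))) atTop (𝓝 ((0 : ℝ) : ℂ)) :=
    (Complex.continuous_ofReal.tendsto _).comp tendsto_inv_one_add_exp
  have h1 : Tendsto (fun β : ℝ => ((((1 + Real.exp (-β))⁻¹ : ℝ) : ℂ))) atTop (𝓝 ((1 : ℝ) : ℂ)) :=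
    (Complex.continuous_ofReal.tendsto _).comp tendsto_inv_one_add_exp_neg
  have h := (h0.mul_const ((1 - P) j i)).add (h1.mul_const (P j i))
  simp only [Complex.ofReal_zero, zero_mul, zero_add, Complex.ofReal_one, one_mul] at h
  refine h.congr' (Eventually.of_forall fun β => ?_)
  exact (gibbsState_two_point hP hPP β i j).symm

/-- The ground-state functional of `dΓ(1 - 2P)` has two-point function `P`:
`ω_∞(c†_i c_j) = P_{ji}` (zero-temperature limit + uniqueness of limits). BLS94 Thm 2.3.
[cite: BachLiebSolovej1994, Thm 2.3] -/
theorem groundStateFunctional_two_point {P : Matrix ι ι ℂ} (hP : P.IsHermitian) (hPP : P * P = P)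
    (i j : ι) :
    (dGamma (hfOneBody P)).groundStateFunctional (creation i * annihilation j) = P j i := by
  haveI : Nonempty (Finset ι) := ⟨∅⟩
  exact tendsto_nhds_unique
    (tendsto_gibbsState_atTop_holds (isHermitian_dGamma (isHermitian_hfOneBody hP)) _)
    (tendsto_gibbsState_two_point hP hPP i j)

/-! ### Wick pairs `⟨n_a n_b⟩` -/

/-- The nested word `c†_a c†_b c_b c_a`. [folklore] -/
theorem wordOp_nestedWord_two (a b : ι) :
    wordOp (nestedWord 2 ![a, b] ![a, b]) = creation a * creation b * annihilation b * annihilation a := by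
  have r0 : Fin.rev (0 : Fin 2) = 1 := by decide
  have r1 : Fin.rev (1 : Fin 2) = 0 := by decide
  simp [nestedWord, wordOp_cons, letterOp, List.ofFn_succ, r0, r1, Matrix.mul_assoc]

/-- `n_a n_b = c†_a c†_b c_b c_a` for `a ≠ b` (CAR). [folklore] -/
theorem numberAt_mul_numberAt_eq {a b : ι} (hab : a ≠ b) :
    numberAt a * numberAt b = creation a * creation b * annihilation b * annihilation a := by
  have h1 : annihilation a * creation b = -(creation b * annihilation a) := by
    have h := annihilation_mul_creation_add_creation_mul_annihilation_holds a b
    rw [if_neg hab] at h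
    exact eq_neg_of_add_eq_zero_left h
  have h2 : annihilation a * annihilation b = -(annihilation b * annihilation a) :=
    eq_neg_of_add_eq_zero_left (annihilation_anticommute_holds a b)
  calc numberAt a * numberAt b
      = creation a * (annihilation a * creation b) * annihilation b := by
        simp only [numberAt, Matrix.mul_assoc]
    _ = -(creation a * creation b * (annihilation a * annihilation b)) := by
        rw [h1]
        simp only [Matrix.mul_neg, Matrix.neg_mul, Matrix.mul_assoc]
    _ = creation a * creation b * annihilation b * annihilation a := by
        rw [h2, Matrix.mul_neg, neg_neg, ← Matrix.mul_assoc]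

/-- **Wick's theorem for a pair of occupation numbers** in the quasi-free Gibbs state of `dΓ(h)`:
`⟨n_a n_b⟩ = ⟨c†_a c_a⟩⟨c†_b c_b⟩ - ⟨c†_a c_b⟩⟨c†_b c_a⟩` (`a ≠ b`; the `2 × 2` case of the
determinant formula `gibbsState_dGamma_nestedWord`). BLS94 eq. (2c.7) (direct minus exchange
term, `α = 0`); Gaudin (1960). [cite: BachLiebSolovej1994, eq. (2c.7)] -/
theorem gibbsState_numberAt_mul_numberAt {h : Matrix ι ι ℂ} (hh : h.IsHermitian) (β : ℝ) {a b : ι}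
    (hab : a ≠ b) :
    gibbsState β (dGamma h) (numberAt a * numberAt b) =
      gibbsState β (dGamma h) (creation a * annihilation a) *
          gibbsState β (dGamma h) (creation b * annihilation b) -
        gibbsState β (dGamma h) (creation a * annihilation b) *
          gibbsState β (dGamma h) (creation b * annihilation a) := by
  rw [numberAt_mul_numberAt_eq hab, ← wordOp_nestedWord_two, gibbsState_dGamma_nestedWord hh β 2,
    Matrix.det_fin_two]
  simp

/-- Zero-temperature Wick pair: `ω_∞(n_a n_b) = P_{aa} P_{bb} - P_{ba} P_{ab}` for `a ≠ b` in the
ground-state functional of `dΓ(1 - 2P)`. BLS94 eq. (2c.7)–(2c.8). [cite: BachLiebSolovej1994, eq. (2c.8)] -/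
theorem groundStateFunctional_numberAt_mul_numberAt {P : Matrix ι ι ℂ} (hP : P.IsHermitian)
    (hPP : P * P = P) {a b : ι} (hab : a ≠ b) :
    (dGamma (hfOneBody P)).groundStateFunctional (numberAt a * numberAt b) =
      P a a * P b b - P b a * P a b := by
  haveI : Nonempty (Finset ι) := ⟨∅⟩
  have hK := isHermitian_dGamma (isHermitian_hfOneBody hP)
  refine tendsto_nhds_unique (tendsto_gibbsState_atTop_holds hK _) ?_
  have h := ((tendsto_gibbsState_two_point hP hPP a a).mul
    (tendsto_gibbsState_two_point hP hPP b b)).sub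
    ((tendsto_gibbsState_two_point hP hPP a b).mul (tendsto_gibbsState_two_point hP hPP b a))
  refine h.congr' (Eventually.of_forall fun β => ?_)
  exact (gibbsState_numberAt_mul_numberAt (isHermitian_hfOneBody hP) β hab).symm

/-- `ω_∞(n_a) = P_{aa}`. [cite: BachLiebSolovej1994, Thm 2.3] -/
theorem groundStateFunctional_numberAt {P : Matrix ι ι ℂ} (hP : P.IsHermitian) (hPP : P * P = P)
    (a : ι) : (dGamma (hfOneBody P)).groundStateFunctional (numberAt a) = P a a :=
  groundStateFunctional_two_point hP hPP a a

/-! ### Particle number: `ω_∞(N̂) = tr P`, `ω_∞(N̂²) = (tr P)²`, hence `ω_∞` lives in one sector -/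

/-- `ω_∞(N̂) = tr P`. [cite: BachLiebSolovej1994, Thm 2.3] -/
theorem groundStateFunctional_totalNumberOp {P : Matrix ι ι ℂ} (hP : P.IsHermitian)
    (hPP : P * P = P) :
    (dGamma (hfOneBody P)).groundStateFunctional totalNumberOp = P.trace := by
  rw [totalNumberOp, map_sum, Matrix.trace]
  exact Finset.sum_congr rfl fun a _ => groundStateFunctional_numberAt hP hPP a

/-- `ω_∞(N̂²) = (tr P)²` for an idempotent `P` (`tr P² = tr P`): the quasi-free ground state of
`dΓ(1 - 2P)` has NO particle-number fluctuations. BLS94 Remark after Thm 2.3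
(`ρ(𝒩²) = Σ_{k,l} ρ(c†_k c_k c†_l c_l)` by Wick; definite particle number iff `γ` is a
projection) and Lemma 2.7 eq. (2b.49). [cite: BachLiebSolovej1994, Lemma 2.7] -/
theorem groundStateFunctional_totalNumberOp_sq {P : Matrix ι ι ℂ} (hP : P.IsHermitian)
    (hPP : P * P = P) :
    (dGamma (hfOneBody P)).groundStateFunctional (totalNumberOp * totalNumberOp) = P.trace ^ 2 := by
  set ω := (dGamma (hfOneBody P)).groundStateFunctional with hω
  set f : ι → ι → ℂ := fun a b => P a a * P b b - P b a * P a b with hf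
  have hpair : ∀ a b : ι, ω (numberAt a * numberAt b) = f a b + (if a = b then P a a else 0) := by
    intro a b
    by_cases hab : a = b
    · subst hab
      rw [if_pos rfl, (numberAt_idempotent a).eq, groundStateFunctional_numberAt hP hPP, hf]
      ring
    · rw [if_neg hab, add_zero, groundStateFunctional_numberAt_mul_numberAt hP hPP hab]
  have hexp : totalNumberOp * totalNumberOp =
      ∑ a : ι, ∑ b : ι, numberAt a * numberAt b := by
    rw [totalNumberOp, Finset.sum_mul]
    exact Finset.sum_congr rfl fun a _ => Finset.mul_sum _ _ _
  have htrsq : (P * P).trace = ∑ a : ι, ∑ b : ι, P b a * P a b := by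
    rw [Matrix.trace]
    refine Finset.sum_congr rfl fun a _ => ?_
    rw [Matrix.diag_apply, Matrix.mul_apply]
    exact Finset.sum_congr rfl fun b _ => mul_comm _ _
  rw [hexp, map_sum]
  simp_rw [map_sum, hpair, Finset.sum_add_distrib, Finset.sum_ite_eq, Finset.mem_univ, if_true,
    hf, Finset.sum_sub_distrib, ← Finset.mul_sum, ← Finset.sum_mul]
  rw [← htrsq, hPP, Matrix.trace]
  simp only [Matrix.diag_apply]
  ring

/-- The number variance vanishes: `ω_∞((N̂ - N)²) = 0` when `tr P = N`. BLS94 Remark after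
Thm 2.3; Lemma 2.7 eq. (2b.49) with `α = 0`. [cite: BachLiebSolovej1994, Lemma 2.7] -/
theorem groundStateFunctional_numberFluct {P : Matrix ι ι ℂ} (hP : P.IsHermitian) (hPP : P * P = P)
    {c : ℂ} (htr : P.trace = c) :
    (dGamma (hfOneBody P)).groundStateFunctional
      ((totalNumberOp - c • (1 : Matrix (Finset ι) (Finset ι) ℂ)) * (totalNumberOp - c • 1)) = 0 := by
  haveI : Nonempty (Finset ι) := ⟨∅⟩
  have hK := isHermitian_dGamma (isHermitian_hfOneBody hP)
  have hexp : (totalNumberOp - c • (1 : Matrix (Finset ι) (Finset ι) ℂ)) * (totalNumberOp - c • 1) =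
      totalNumberOp * totalNumberOp - c • totalNumberOp - c • totalNumberOp + (c * c) • 1 := by
    simp only [sub_mul, mul_sub, mul_smul_comm, smul_mul_assoc, mul_one, one_mul, smul_sub, smul_smul]
    abel
  rw [hexp, map_add, map_sub, map_sub, map_smul, map_smul,
    groundStateFunctional_totalNumberOp_sq hP hPP, groundStateFunctional_totalNumberOp hP hPP,
    groundStateFunctional_one hK, htr, smul_eq_mul, smul_eq_mul]
  ring

/-- `N̂` is Hermitian. [folklore] -/
theorem conjTranspose_totalNumberOp :
    (totalNumberOp : Matrix (Finset ι) (Finset ι) ℂ)ᴴ = totalNumberOp := by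
  rw [totalNumberOp_eq_diagonal, Matrix.diagonal_conjTranspose]
  congr 1
  funext s
  simp

/-- **The ground projector of `dΓ(1 - 2P)` lies in the `N`-particle sector**, `N = tr P`:
`N̂ P₀ = N P₀` (from `ω_∞((N̂ - N)²) = 0`: `tr (P₀ M²) = ‖M P₀‖² = 0` for `M = N̂ - N`).
BLS94 Remark after Thm 2.3 (projections have definite particle number). [cite: BachLiebSolovej1994, Thm 2.3] -/
theorem totalNumberOp_mul_groundProj {P : Matrix ι ι ℂ} (hP : P.IsHermitian) (hPP : P * P = P)
    {c : ℂ} (htr : P.trace = c) :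
    totalNumberOp * (dGamma (hfOneBody P)).groundProj = c • (dGamma (hfOneBody P)).groundProj := by
  haveI : Nonempty (Finset ι) := ⟨∅⟩
  set K := dGamma (hfOneBody P) with hKdef
  have hK : K.IsHermitian := isHermitian_dGamma (isHermitian_hfOneBody hP)
  set P₀ := K.groundProj with hP₀
  have hP₀sq : P₀ * P₀ = P₀ := by rw [hP₀]; exact groundProj_mul_self K
  have hP₀h : P₀ᴴ = P₀ := by rw [hP₀]; exact (groundProj_isHermitian K).eq
  set M : Matrix (Finset ι) (Finset ι) ℂ := totalNumberOp - c • 1 with hM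
  have hMh : Mᴴ = M := by
    have hc : star c = c := by
      rw [← htr, Matrix.trace]
      simp only [star_sum, Matrix.diag_apply]
      exact Finset.sum_congr rfl fun i _ => hP.apply i i
    rw [hM, conjTranspose_sub, conjTranspose_smul, conjTranspose_one, conjTranspose_totalNumberOp, hc]
  have h0 : (P₀ * (M * M)).trace = 0 := by
    have h := groundStateFunctional_numberFluct hP hPP htr
    rw [groundStateFunctional_apply, mul_eq_zero] at h
    rcases h with h | h
    · exact absurd (inv_eq_zero.mp h) (trace_groundProj_ne_zero hK)
    · exact h
  have hA : (M * P₀)ᴴ * (M * P₀) = 0 := by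
    have hpsd := posSemidef_conjTranspose_mul_self (M * P₀)
    refine hpsd.trace_eq_zero_iff.mp ?_
    calc ((M * P₀)ᴴ * (M * P₀)).trace = (P₀ * (M * (M * P₀))).trace := by
          rw [conjTranspose_mul, hP₀h, hMh, Matrix.mul_assoc]
      _ = ((M * (M * P₀)) * P₀).trace := trace_mul_comm _ _
      _ = (M * (M * P₀)).trace := by rw [Matrix.mul_assoc, Matrix.mul_assoc, hP₀sq]
      _ = (P₀ * (M * M)).trace := by rw [← Matrix.mul_assoc, trace_mul_comm]
      _ = 0 := h0
  have hMP : M * P₀ = 0 := Matrix.conjTranspose_mul_self_eq_zero.mp hA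
  rw [hM, sub_mul, sub_eq_zero, smul_mul_assoc, one_mul] at hMP
  exact hMP

/-- Every column of the ground projector of `dΓ(1 - 2P)` is an `N`-particle vector, `N = tr P`.
BLS94 Remark after Thm 2.3. [cite: BachLiebSolovej1994, Thm 2.3] -/
theorem isNParticle_groundProj_col {P : Matrix ι ι ℂ} (hP : P.IsHermitian) (hPP : P * P = P)
    {N : ℕ} (htr : P.trace = N) (s : Finset ι) :
    IsNParticle N (fun r => (dGamma (hfOneBody P)).groundProj r s) := by
  intro r hr
  have h := congrFun (congrFun (totalNumberOp_mul_groundProj hP hPP htr) r) s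
  rw [totalNumberOp_eq_diagonal, diagonal_mul, Matrix.smul_apply, smul_eq_mul] at h
  have h' : ((r.card : ℂ) - N) * (dGamma (hfOneBody P)).groundProj r s = 0 := by
    rw [sub_mul, h, sub_self]
  rcases mul_eq_zero.mp h' with h'' | h''
  · exact absurd (by exact_mod_cast (sub_eq_zero.mp h'')) hr
  · exact h''

/-! ### The variational step: `E₀(N) ≤ re ω_∞(H)` -/

/-- **Variational principle for the quasi-free ground state**: for ANY operator `H` on Fock space,
`E₀(N) ≤ re ω_∞(H)`, where `ω_∞` is the ground-state functional of `dΓ(1 - 2P)`, `tr P = N`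
(`ω_∞ = tr(P₀ ·)/tr P₀` is a mixture of the `N`-particle vector states given by the columns of `P₀`).
BLS94 (2c.36) (`E^Q ≤ ℰ(γ)`). [cite: BachLiebSolovej1994, eq. (2c.36)] -/
theorem groundEnergy_le_re_groundStateFunctional {P : Matrix ι ι ℂ} (hP : P.IsHermitian)
    (hPP : P * P = P) {N : ℕ} (htr : P.trace = N) (H : Matrix (Finset ι) (Finset ι) ℂ) :
    groundEnergy H N ≤ ((dGamma (hfOneBody P)).groundStateFunctional H).re := by
  haveI : Nonempty (Finset ι) := ⟨∅⟩
  set K := dGamma (hfOneBody P) with hKdef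
  have hK : K.IsHermitian := isHermitian_dGamma (isHermitian_hfOneBody hP)
  set P₀ := K.groundProj with hP₀
  have hP₀sq : P₀ * P₀ = P₀ := by rw [hP₀]; exact groundProj_mul_self K
  have hP₀h : P₀.IsHermitian := by rw [hP₀]; exact groundProj_isHermitian K
  -- the columns of `P₀`
  set col : Finset ι → Fock ι := fun s r => P₀ r s with hcol
  have hstar : ∀ r s, star (P₀ r s) = P₀ s r := fun r s => hP₀h.apply s r
  -- `tr (P₀ H) = Σ_s ⟨col_s, H col_s⟩`
  have hexp : ∀ s, expect H (col s) = (P₀ * (H * P₀)) s s := by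
    intro s
    simp only [expect, dotProduct, mulVec, Matrix.mul_apply, hcol, Pi.star_apply, hstar,
      Finset.mul_sum]
  have htrH : (P₀ * H).trace = ∑ s, expect H (col s) := by
    have h1 : (P₀ * (H * P₀)).trace = (P₀ * H).trace := by
      rw [trace_mul_comm, Matrix.mul_assoc, hP₀sq, trace_mul_comm]
    rw [← h1, Matrix.trace]
    exact Finset.sum_congr rfl fun s _ => (hexp s).symm
  -- `tr P₀ = Σ_s ‖col_s‖²`
  have hnorm : ∑ s, star (col s) ⬝ᵥ col s = P₀.trace := by
    conv_rhs => rw [← hP₀sq]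
    rw [Matrix.trace]
    refine Finset.sum_congr rfl fun s _ => ?_
    simp only [Matrix.diag_apply, Matrix.mul_apply, dotProduct, hcol, Pi.star_apply, hstar]
  -- positivity of `tr P₀`
  have hpos : 0 < P₀.trace := by rw [hP₀]; exact trace_groundProj_pos hK
  obtain ⟨hre, him⟩ := Complex.lt_def.mp hpos
  rw [Complex.zero_re] at hre
  rw [Complex.zero_im] at him
  have htrre : P₀.trace = ((P₀.trace.re : ℝ) : ℂ) := by
    apply Complex.ext <;> simp [← him]
  -- the bound `E₀ · tr P₀ ≤ re tr (P₀ H)`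
  have hmain : groundEnergy H N * P₀.trace.re ≤ ((P₀ * H).trace).re := by
    rw [htrH, Complex.re_sum, ← hnorm, Complex.re_sum, Finset.mul_sum]
    exact Finset.sum_le_sum fun s _ =>
      LiebThm1.groundEnergy_mul_norm_le H (isNParticle_groundProj_col hP hPP htr s)
  rw [groundStateFunctional_apply]
  change groundEnergy H N ≤ ((P₀.trace)⁻¹ * (P₀ * H).trace).re
  rw [htrre, ← Complex.ofReal_inv, Complex.re_ofReal_mul, le_inv_mul_iff₀ hre, mul_comm]
  exact hmain

end Gibbs

/-! ### The Hubbard model: `ω_∞(H) = E_HF(P)` and the Hartree–Fock bound -/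

section Hubbard

variable {Λ : Type*} [LinearOrder Λ] [Fintype Λ] (G : SimpleGraph Λ) [DecidableRel G.Adj]

/-- The **Hartree–Fock energy functional** of the Hubbard model on `G` at a one-particle density
matrix `P` on `Orb Λ = Λ × {↑,↓}`:
`E_HF(P) = -t Σ_{x∼y,σ} P_{(yσ),(xσ)} + U Σ_x (P_{x↑,x↑} P_{x↓,x↓} - P_{x↓,x↑} P_{x↑,x↓})`
(kinetic term `tr (T P)` for the tree's ordered-pair hopping sum; direct minus exchange on-site
term). BLS94 eqs. (2c.8), (2c.34)–(2c.35) specialised to `V = U Σ_x n_{x↑}n_{x↓}`.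
[cite: BachLiebSolovej1994, eq. (2c.8)] -/
def hfEnergy (t U : ℝ) (P : Matrix (Orb Λ) (Orb Λ) ℂ) : ℂ :=
  -(t : ℂ) * (∑ x : Λ, ∑ y : Λ, ∑ σ : Fin 2, if G.Adj x y then P (orb y σ) (orb x σ) else 0) +
    (U : ℂ) * ∑ x : Λ, (P (orb x 0) (orb x 0) * P (orb x 1) (orb x 1) -
      P (orb x 1) (orb x 0) * P (orb x 0) (orb x 1))

/-- **The energy of the quasi-free ground state of `dΓ(1 - 2P)` in the Hubbard model is the
Hartree–Fock functional**: `ω_∞(H(t,U)) = E_HF(P)` (two-point function `P`, Wick pairs for the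
on-site term). BLS94 eqs. (2c.7)–(2c.8). [cite: BachLiebSolovej1994, eq. (2c.8)] -/
theorem groundStateFunctional_hamiltonian {P : Matrix (Orb Λ) (Orb Λ) ℂ} (hP : P.IsHermitian)
    (hPP : P * P = P) (t U : ℝ) :
    (dGamma (hfOneBody P)).groundStateFunctional (hamiltonian G t U) = hfEnergy G t U P := by
  set ω := (dGamma (hfOneBody P)).groundStateFunctional with hω
  have hhop : ∀ (x y : Λ) (σ : Fin 2),
      ω (if G.Adj x y then creation (orb x σ) * annihilation (orb y σ) else 0) =
        if G.Adj x y then P (orb y σ) (orb x σ) else 0 := by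
    intro x y σ
    split_ifs with h
    · exact groundStateFunctional_two_point hP hPP _ _
    · exact map_zero ω
  have hint : ∀ x : Λ, ω (numberOp x 0 * numberOp x 1) =
      P (orb x 0) (orb x 0) * P (orb x 1) (orb x 1) - P (orb x 1) (orb x 0) * P (orb x 0) (orb x 1) := by
    intro x
    rw [← numberAt_orb, ← numberAt_orb]
    exact groundStateFunctional_numberAt_mul_numberAt hP hPP (EtaPairingODLRO.orb_zero_ne_orb_one x)
  rw [hamiltonian, hfEnergy, map_add, map_smul, map_smul, smul_eq_mul, smul_eq_mul]
  simp only [map_sum, hhop, hint]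

/-- **Hartree–Fock (Slater-determinant) upper bound for the Hubbard model.** On any finite graph,
for all real `t, U` and every orthogonal projection `P` on the one-particle space with `tr P = N`:
`E₀(N) ≤ re E_HF(P) = re [ -t Σ_{x∼y,σ} P_{(yσ),(xσ)} + U Σ_x (P_{x↑,x↑}P_{x↓,x↓} - P_{x↓,x↑}P_{x↑,x↓}) ]`.
Bach–Lieb–Solovej (1994) eqs. (2c.34)–(2c.36) with `γ = P` an `N`-dimensional projection (the
one-particle density matrix of a Slater determinant), realised here by the quasi-free ground
state of `dΓ(1 - 2P)` (Thm 2.3, Lemma 2.5) and the variational principle.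
[cite: BachLiebSolovej1994, eq. (2c.36)] -/
theorem groundEnergyAt_le_hfEnergy (t U : ℝ) {P : Matrix (Orb Λ) (Orb Λ) ℂ} (hP : P.IsHermitian)
    (hPP : P * P = P) {N : ℕ} (htr : P.trace = N) :
    groundEnergyAt G t U N ≤ (hfEnergy G t U P).re := by
  rw [groundEnergyAt, ← groundStateFunctional_hamiltonian G hP hPP t U]
  exact groundEnergy_le_re_groundStateFunctional hP hPP htr _

/-- Per-site form: `energyPerSite ≤ re E_HF(P) / |Λ|`. [cite: BachLiebSolovej1994, eq. (2c.36)] -/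
theorem energyPerSite_le_hfEnergy_div (t U : ℝ) {P : Matrix (Orb Λ) (Orb Λ) ℂ} (hP : P.IsHermitian)
    (hPP : P * P = P) {N : ℕ} (htr : P.trace = N) :
    energyPerSite G t U N ≤ (hfEnergy G t U P).re / Fintype.card Λ := by
  unfold energyPerSite
  by_cases hΛ : (Fintype.card Λ : ℝ) = 0
  · simp [hΛ]
  · exact div_le_div_of_nonneg_right (groundEnergyAt_le_hfEnergy G t U hP hPP htr)
      (Nat.cast_nonneg _)

end Hubbard

end HartreeFock

end Literature.MathematicalPhysics.QuantumLattice
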